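import Mathlib
import Summits.NavierStokesRegularity.NavierStokesRegularity.Theorems.TypeILiouvilleLatticeScaled
import Summits.NavierStokesRegularity.NavierStokesRegularity.Theorems.TypeILiouvilleLatticeTypeIDoor
import Summits.NavierStokesRegularity.NavierStokesRegularity.Theorems.TypeILiouvilleShorelineLocalSymmetry

/-!
# TypeILiouvilleLatticeLocal — crux (L) stmt-NavierStokesRegularity-10661 `TypeIliouvilleL`:
# ONE-PATCH LATTICE SYMMETRY OF ONE SLICE KILLS (class P and the Type-I door)

Helper for stmt-NavierStokesRegularity-10661 (`--supports`); theorems only, no definitions, no named-fact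
hypotheses; closes no item; Navier–Stokes regularity is NOT proved here (leafhand seat of the
EulerZoomLiouville route, LAND-ONLY).

By the landed one-patch determination «LOCAL SPATIAL PERIODICITY IS GLOBAL»
(`TypeILiouvilleShoreline.classP_spacePeriodic_of_locallyPeriodic`, Lemarié-Rieusset 2016 Thm 9.12) the periodic
sieve needs its symmetry only on ONE nonempty open set at ONE negative time:

* `classP_const_of_locallyLatticePeriodic` — a member of print's class P one of whose slices agrees, on one
  nonempty open set, with its three unit translates is ONE CONSTANT VECTOR
  (∘ `TypeILiouvilleLatticeMomentum.classP_const_of_isLatticePeriodic`).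
* `classP_const_of_locallyCubicPeriodic` — the same for the translates by `L·R e_j` of any cubic lattice
  (∘ `classP_const_of_isLatticePeriodic_cubic`).
* `typeIAncientLiouville_onLocalLattice` — the Type-I door (stmt-4050 = registered stub
  `stub_typeIAncientLiouville_knssGauge`, binders VERBATIM) for fields one of whose slices is lattice periodic on
  one patch: `u ≡ 0` (∘ `typeI_eq_zero_of_isLatticePeriodic`, through the class-P shifts
  `TypeILiouvilleTypeIDoorLocalAxis.typeI_shift_classP`).

[cite: KochNadirashviliSereginSverak2009, §4 p. 8 (arXiv:0709.3599)]; [cite: LemarieRieusset2016, Thm. 9.12 (PDF p. 260)]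
-/

noncomputable section
open MeasureTheory Filter Set Function Metric
open scoped Topology
open Literature.Analysis Literature.Analysis.FunctionSpaces Literature.Analysis.FluidPDE
  Literature.Analysis.UnboundedOperators
set_option linter.dupNamespace false
namespace Summit.NavierStokesRegularity.NavierStokesRegularity.Theorems.TypeILiouvilleLatticeMomentum

/-- **One-patch lattice symmetry kills (class P).**  If one slice `v t₀` (`t₀ < 0`) of a member of print's class
P satisfies `v t₀ (x + e_j) = v t₀ x` (`j = 0,1,2`) for `x` in ONE nonempty open set, then `v` is one constant
vector on `t < 0`. [cite: LemarieRieusset2016, Thm. 9.12 (PDF p. 260)] -/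
theorem classP_const_of_locallyLatticePeriodic
    {v : ℝ → EuclideanSpace ℝ (Fin 3) → EuclideanSpace ℝ (Fin 3)}
    (hc : ContinuousOn (uncurry v) (Iio 0 ×ˢ univ))
    (hK : ∃ K : ℝ, ∀ t < 0, ∀ x, ‖v t x‖ ≤ K)
    (hd : ∀ t < 0, IsWeaklyDivFree (v t))
    (hm : ∀ s t : ℝ, s < t → t < 0 → ∀ x,
      v t x = heatExtension (v s) (t - s) x - oseenDuhamel 1 s v v t x)
    {t₀ : ℝ} (ht₀ : t₀ < 0) {U : Set (EuclideanSpace ℝ (Fin 3))} (hUo : IsOpen U) (hUne : U.Nonempty)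
    (hloc : ∀ (j : Fin 3), ∀ x ∈ U, v t₀ (x + EuclideanSpace.single j 1) = v t₀ x) :
    ∃ b : EuclideanSpace ℝ (Fin 3), ∀ t < 0, ∀ x, v t x = b := by
  have hper : ∀ t < 0, Torus.IsLatticePeriodic (v t) := fun t ht j x =>
    TypeILiouvilleShoreline.classP_spacePeriodic_of_locallyPeriodic hc hK hm
      (EuclideanSpace.single j 1) ht₀ hUo hUne (hloc j) t ht x
  exact classP_const_of_isLatticePeriodic hc hK hd hm hper

/-- **One-patch cubic-lattice symmetry kills (class P).**  The same for the translates by `L·R e_j` (`L > 0`, `R`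
a linear isometry): agreement on one nonempty open set at one negative time forces `v` to be one constant
vector. [cite: LemarieRieusset2016, Thm. 9.12 (PDF p. 260)] -/
theorem classP_const_of_locallyCubicPeriodic
    {v : ℝ → EuclideanSpace ℝ (Fin 3) → EuclideanSpace ℝ (Fin 3)}
    (hc : ContinuousOn (uncurry v) (Iio 0 ×ˢ univ))
    (hK : ∃ K : ℝ, ∀ t < 0, ∀ x, ‖v t x‖ ≤ K)
    (hd : ∀ t < 0, IsWeaklyDivFree (v t))
    (hm : ∀ s t : ℝ, s < t → t < 0 → ∀ x,
      v t x = heatExtension (v s) (t - s) x - oseenDuhamel 1 s v v t x)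
    (R : EuclideanSpace ℝ (Fin 3) ≃ₗᵢ[ℝ] EuclideanSpace ℝ (Fin 3)) {L : ℝ} (hL : 0 < L)
    {t₀ : ℝ} (ht₀ : t₀ < 0) {U : Set (EuclideanSpace ℝ (Fin 3))} (hUo : IsOpen U) (hUne : U.Nonempty)
    (hloc : ∀ (j : Fin 3), ∀ x ∈ U, v t₀ (x + L • R (EuclideanSpace.single j 1)) = v t₀ x) :
    ∃ b : EuclideanSpace ℝ (Fin 3), ∀ t < 0, ∀ x, v t x = b := by
  have hper : ∀ t < 0, ∀ (j : Fin 3) (x : EuclideanSpace ℝ (Fin 3)),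
      v t (x + L • R (EuclideanSpace.single j 1)) = v t x := fun t ht j x =>
    TypeILiouvilleShoreline.classP_spacePeriodic_of_locallyPeriodic hc hK hm
      (L • R (EuclideanSpace.single j 1)) ht₀ hUo hUne (hloc j) t ht x
  exact classP_const_of_isLatticePeriodic_cubic hc hK hd hm R hL hper

/-- **One-patch lattice symmetry kills a Type-I field.**  A KNSS-gauge Type-I ancient mild field one of whose
slices agrees with its three unit translates on one nonempty open set vanishes identically (the class-P
shifts `W(· − δ)` inherit global periodicity from the patch, for every `0 < δ < −τ₁`; then
`typeI_eq_zero_of_isLatticePeriodic`). [cite: KochNadirashviliSereginSverak2009, §4 (i) p. 8 and (1.4) (arXiv:0709.3599)] -/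
theorem typeI_eq_zero_of_locallyLatticePeriodic {C : ℝ}
    {W : ℝ → EuclideanSpace ℝ (Fin 3) → EuclideanSpace ℝ (Fin 3)} (hW : IsTypeIAncientMild C W)
    {τ₁ : ℝ} (hτ₁ : τ₁ < 0) {U : Set (EuclideanSpace ℝ (Fin 3))} (hUo : IsOpen U) (hUne : U.Nonempty)
    (hloc : ∀ (j : Fin 3), ∀ x ∈ U, W τ₁ (x + EuclideanSpace.single j 1) = W τ₁ x) :
    ∀ t < 0, ∀ x, W t x = 0 := by
  have hper : ∀ t < 0, Torus.IsLatticePeriodic (W t) := by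
    intro t ht j x
    -- shift by `δ = min (−t) (−τ₁) / 2`
    set δ : ℝ := min (-t) (-τ₁) / 2 with hδdef
    have hmin : 0 < min (-t) (-τ₁) := lt_min (by linarith) (by linarith)
    have hδ : 0 < δ := by rw [hδdef]; linarith
    have hδt : t + δ < 0 := by
      have : min (-t) (-τ₁) ≤ -t := min_le_left _ _
      rw [hδdef]; linarith
    have hδτ : τ₁ + δ < 0 := by
      have : min (-t) (-τ₁) ≤ -τ₁ := min_le_right _ _
      rw [hδdef]; linarith
    obtain ⟨hc, hK, hm⟩ := TypeILiouvilleTypeIDoorLocalAxis.typeI_shift_classP hW hδ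
    have hloc' : ∀ y ∈ U, (fun t x => W (t - δ) x) (τ₁ + δ) (y + EuclideanSpace.single j 1) =
        (fun t x => W (t - δ) x) (τ₁ + δ) y := by
      intro y hy
      simp only [add_sub_cancel_right]
      exact hloc j y hy
    have h := TypeILiouvilleShoreline.classP_spacePeriodic_of_locallyPeriodic hc hK hm
      (EuclideanSpace.single j 1) hδτ hUo hUne hloc' (t + δ) hδt x
    simpa only [add_sub_cancel_right] using h
  exact typeI_eq_zero_of_isLatticePeriodic hW hper

/-- **The Type-I door on the one-patch lattice stratum, binders VERBATIM** (`Theses.SymmetryModuliCount.TypeIAncientLiouville`,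
stmt-4050 = `stub_typeIAncientLiouville_knssGauge` of the (L) skeleton): a smooth, divergence-free,
Oseen-kernel-mild, Type-I-in-time field one of whose slices agrees with its three unit translates on one nonempty
open set vanishes identically. [cite: KochNadirashviliSereginSverak2009, §4 (i) p. 8 and (1.4) (arXiv:0709.3599)] -/
theorem typeIAncientLiouville_onLocalLattice :
    ∀ (C : ℝ) (u : ℝ → EuclideanSpace ℝ (Fin 3) → EuclideanSpace ℝ (Fin 3)),
      ContDiffOn ℝ (⊤ : ℕ∞) (Function.uncurry u) (Set.Iio 0 ×ˢ Set.univ) ∧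
      (∀ t < 0, Literature.Analysis.FluidPDE.VectorCalculus.IsDivFree (u t)) ∧
      (∀ s t : ℝ, s < t → t < 0 → ∀ x,
        u t x = Literature.Analysis.FluidPDE.heatFlow (u s) (t - s) x -
          ∫ τ in Set.Ioo s t, ∫ y,
            Literature.Analysis.FluidPDE.oseenKernel (t - τ) (x - y) (u τ y) (u τ y)) ∧
      Literature.Analysis.FluidPDE.HasTypeITimeDecay C u →
      (∃ (τ₁ : ℝ) (U : Set (EuclideanSpace ℝ (Fin 3))), τ₁ < 0 ∧ IsOpen U ∧ U.Nonempty ∧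
          ∀ (j : Fin 3), ∀ x ∈ U, u τ₁ (x + EuclideanSpace.single j 1) = u τ₁ x) →
      ∀ t < 0, ∀ x, u t x = 0 := by
  intro C u hu hloc
  obtain ⟨τ₁, U, hτ₁, hUo, hUne, hl⟩ := hloc
  exact typeI_eq_zero_of_locallyLatticePeriodic (isTypeIAncientMild_iff.2 hu) hτ₁ hUo hUne hl

end Summit.NavierStokesRegularity.NavierStokesRegularity.Theorems.TypeILiouvilleLatticeMomentum

end
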